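import Literature.NumberTheory.GaloisCohomology.BrauerSumInvCyclicClassOdd
import HarnessLib

/-!
# The cyclic reciprocity law for `b` positive at the real places

The archimedean hypothesis `hinf` of `sum_localInvariantMap_localization_cupProduct_δ₀_eq_zero`
(the Artin map `ψ_{L|K}` kills the archimedean idèle of `b`) holds whenever `b` is POSITIVE at every
real place of `K` — with no condition on `L` (Neukirch VI (5.6)–(5.8): the local Artin map at a real
place kills `ℝ_{>0}`, at a complex place everything).  In the tree's dialect: an archimedean idèle
that is positive at the real places is a square of `K_∞ˣ`, hence lies in the identity component
(`sq_mem_connectedComponent_one_units_infiniteAdeleRing`), which every norm group contains.  This is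
the archimedean input of the `2`-primary part of Tate's reciprocity law over fields with real places.

* `isSquare_units_infiniteAdeleRing_of_pos`, `mem_connectedComponent_one_units_infiniteAdeleRing_of_pos`;
* `artinIdeleMap_infiniteIdeles_eq_one_of_pos`;
* `sum_localInvariantMap_localization_cupProduct_δ₀_eq_zero_of_pos` — the sum formula for `b ∈ Kˣ`
  positive at all real places, any level, any `L`.

## References

* J. Neukirch, *Algebraic Number Theory* (1999), Ch. VI §5 (5.6)–(5.8). [NeukirchANT1999]
* J. Tate, *Global class field theory*, Ch. VII of Cassels–Fröhlich (1967), §10. [CasselsFrohlichANT1967]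
-/

noncomputable section

open CategoryTheory Function NumberField IsDedekindDomain Field ValuativeRel
open scoped NumberField

namespace Literature.NumberTheory.GaloisCohomology

open _root_.ContinuousCohomology
open Literature.NumberTheory.GaloisRepresentations
open Literature.NumberTheory.GaloisRepresentations.DiscreteGaloisModule
open Literature.NumberTheory.GaloisRepresentations.LocalWeilDatum
open Literature.NumberTheory.GaloisRepresentations.IsNonarchimedeanLocalField
open Literature.NumberTheory.NumberFields
open Literature.AnabelianGeometry.AbsoluteAnabelian
open Literature.AnabelianGeometry.AbsoluteAnabelian.Prop121vii

variable {K : Type} [Field K] [NumberField K]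

/-! ### §1. Positive archimedean idèles are squares -/

omit [NumberField K] in
/-- At a real place `w`, a unit of `K_w ≅ ℝ` with positive image is a square; at a complex place every
unit of `K_w ≅ ℂ` is a square. [cite: NeukirchANT1999, Ch. VI §5 Prop. (5.6)] -/
theorem isSquare_units_completion_of_pos (w : InfinitePlace K) (z : (w.Completion)ˣ)
    (hz : ∀ hw : w.IsReal, 0 < InfinitePlace.Completion.extensionEmbeddingOfIsReal hw (z : w.Completion)) :
    IsSquare z := by
  rcases w.isReal_or_isComplex with hw | hw
  · let e : w.Completion ≃+* ℝ := InfinitePlace.Completion.ringEquivRealOfIsReal hw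
    have hpos : 0 < e (z : w.Completion) := hz hw
    set t : w.Completion := e.symm (Real.sqrt (e (z : w.Completion))) with ht
    have ht2 : t * t = (z : w.Completion) := by
      apply e.injective
      rw [map_mul, ht, e.apply_symm_apply, Real.mul_self_sqrt hpos.le]
    have ht0 : t ≠ 0 := fun h => z.ne_zero (by rw [← ht2, h, mul_zero])
    exact ⟨Units.mk0 t ht0, Units.ext (by rw [Units.val_mul, Units.val_mk0, ht2])⟩
  · let e : w.Completion ≃+* ℂ := InfinitePlace.Completion.ringEquivComplexOfIsComplex hw
    obtain ⟨s, hs⟩ := IsAlgClosed.exists_eq_mul_self (e (z : w.Completion))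
    set t : w.Completion := e.symm s with ht
    have ht2 : t * t = (z : w.Completion) := by
      apply e.injective
      rw [map_mul, ht, e.apply_symm_apply, ← hs]
    have ht0 : t ≠ 0 := fun h => z.ne_zero (by rw [← ht2, h, mul_zero])
    exact ⟨Units.mk0 t ht0, Units.ext (by rw [Units.val_mul, Units.val_mk0, ht2])⟩

omit [NumberField K] in
/-- **An archimedean idèle positive at every real place is a square of `K_∞ˣ`.**
[cite: NeukirchANT1999, Ch. VI §5 Prop. (5.6)] -/
theorem isSquare_units_infiniteAdeleRing_of_pos (u : (InfiniteAdeleRing K)ˣ)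
    (hu : ∀ (w : InfinitePlace K) (hw : w.IsReal),
      0 < InfinitePlace.Completion.extensionEmbeddingOfIsReal hw ((u : InfiniteAdeleRing K) w)) :
    IsSquare u := by
  let e := (ContinuousMulEquiv.piUnits (M := fun w : InfinitePlace K => w.Completion))
  have hsq : ∀ w, IsSquare (e (u : (Π w : InfinitePlace K, w.Completion)ˣ) w) := fun w =>
    isSquare_units_completion_of_pos w _ (fun hw => hu w hw)
  choose r hr using hsq
  refine ⟨(e.symm r : (Π w : InfinitePlace K, w.Completion)ˣ), ?_⟩
  apply e.injective
  change e (u : (Π w : InfinitePlace K, w.Completion)ˣ) = e (e.symm r * e.symm r)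
  rw [map_mul, e.apply_symm_apply]
  funext w
  rw [Pi.mul_apply]
  exact hr w

omit [NumberField K] in
/-- **An archimedean idèle positive at every real place lies in the identity component of `K_∞ˣ`**
(it is a square, `sq_mem_connectedComponent_one_units_infiniteAdeleRing`).
[cite: NeukirchANT1999, Ch. VI §5 Prop. (5.6)] -/
theorem mem_connectedComponent_one_units_infiniteAdeleRing_of_pos (u : (InfiniteAdeleRing K)ˣ)
    (hu : ∀ (w : InfinitePlace K) (hw : w.IsReal),
      0 < InfinitePlace.Completion.extensionEmbeddingOfIsReal hw ((u : InfiniteAdeleRing K) w)) :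
    u ∈ connectedComponent (1 : (InfiniteAdeleRing K)ˣ) := by
  obtain ⟨r, hr⟩ := isSquare_units_infiniteAdeleRing_of_pos u hu
  rw [hr, ← pow_two]
  exact sq_mem_connectedComponent_one_units_infiniteAdeleRing r

/-! ### §2. The Artin map kills positive archimedean idèles -/

variable (L : IntermediateField K (AlgebraicClosure K)) [FiniteDimensional K L] [IsAbelianGalois K L]
  [NumberField L]

/-- **`ψ_{L|K}` kills every archimedean idèle that is positive at the real places** (any finite abelian
`L/K`): the idèle lies in the identity component of `K_∞ˣ`, whose image in `C_K` lies in the identity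
component, contained in the norm group `N_{L|K} C_L = ker ψ_{L|K}`.
[cite: NeukirchANT1999, Ch. VI §5 Cor. (5.8)] -/
theorem artinIdeleMap_infiniteIdeles_eq_one_of_pos (u : (InfiniteAdeleRing K)ˣ)
    (hu : ∀ (w : InfinitePlace K) (hw : w.IsReal),
      0 < InfinitePlace.Completion.extensionEmbeddingOfIsReal hw ((u : InfiniteAdeleRing K) w)) :
    artinIdeleMap L artinReciprocity_character_holds (infiniteIdeles K u) = 1 := by
  have hconn : (QuotientGroup.mk (infiniteIdeles K u) : ideleGroup K ⧸ principalIdeles K) ∈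
      connectedComponent (1 : ideleGroup K ⧸ principalIdeles K) := by
    have hc : Continuous fun y : (InfiniteAdeleRing K)ˣ =>
        (QuotientGroup.mk (infiniteIdeles K y) : ideleGroup K ⧸ principalIdeles K) :=
      QuotientGroup.continuous_mk.comp (Automorphic.continuous_infiniteIdeles K)
    have h := hc.image_connectedComponent_subset (1 : (InfiniteAdeleRing K)ˣ)
    rw [map_one, QuotientGroup.mk_one] at h
    exact h ⟨u, mem_connectedComponent_one_units_infiniteAdeleRing_of_pos u hu, rfl⟩
  have hmem := connectedComponent_one_subset_normClassGroup L hconn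
  rw [← ker_artinClassMap_eq L, SetLike.mem_coe, MonoidHom.mem_ker, artinClassMap_mk] at hmem
  exact hmem

/-! ### §3. The sum formula for `b` positive at the real places -/

/-- **`∑_{v ∈ S} inv_v (loc_v (κₙ(b) ∪ ψ)) = 0` for `b ∈ Kˣ` positive at every real place of `K`**,
any level `n`, any finite abelian `L` cut out by `ψ` (Tate, Cassels–Fröhlich VII §10): the archimedean
hypothesis of `sum_localInvariantMap_localization_cupProduct_δ₀_eq_zero` is
`artinIdeleMap_infiniteIdeles_eq_one_of_pos`. [cite: CasselsFrohlichANT1967, Ch. VII §10] -/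
theorem sum_localInvariantMap_localization_cupProduct_δ₀_eq_zero_of_pos {n : ℕ} [NeZero n]
    (ψ : CyclicCharacter (absoluteGaloisGroup K) n) (hker : ψ.ker = galFixing K L) (b : Kˣ)
    (hpos : ∀ (w : InfinitePlace K) (hw : w.IsReal),
      0 < InfinitePlace.Completion.extensionEmbeddingOfIsReal hw (algebraMap K w.Completion (b : K)))
    (hram : ∀ v : HeightOneSpectrum (𝓞 K),
      (∃ σ ∈ absInertia (v.adicCompletion K), ψ (absGaloisRestrict K (v.adicCompletion K) σ) ≠ 0) →
      haveI : CompactSpace (absoluteGaloisGroup K) := absoluteGaloisGroup_compactSpace K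
      galoisCohomology.localization (mu K n) (Sum.inr v) 2 (((mu K n).tateDualPairing n).cupProduct
        ((isSES_kummer K n (NeZero.pos n)).δ₀ (baseUnitsInvariant K (b : K) b.ne_zero))
        (oneCocycleClass _ (scalarCocycle ψ))) = 0)
    (S : Finset (HeightOneSpectrum (𝓞 K)))
    (hS : ∀ v ∉ S,
      haveI : CompactSpace (absoluteGaloisGroup K) := absoluteGaloisGroup_compactSpace K
      localInvariantMap K n v (galoisCohomology.localization (mu K n) (Sum.inr v) 2
        (((mu K n).tateDualPairing n).cupProduct
          ((isSES_kummer K n (NeZero.pos n)).δ₀ (baseUnitsInvariant K (b : K) b.ne_zero))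
          (oneCocycleClass _ (scalarCocycle ψ)))) = 0) :
    haveI : CompactSpace (absoluteGaloisGroup K) := absoluteGaloisGroup_compactSpace K
    ∑ v ∈ S, localInvariantMap K n v (galoisCohomology.localization (mu K n) (Sum.inr v) 2
        (((mu K n).tateDualPairing n).cupProduct
          ((isSES_kummer K n (NeZero.pos n)).δ₀ (baseUnitsInvariant K (b : K) b.ne_zero))
          (oneCocycleClass _ (scalarCocycle ψ)))) = 0 := by
  refine sum_localInvariantMap_localization_cupProduct_δ₀_eq_zero L ψ hker b ?_ hram S hS
  refine artinIdeleMap_infiniteIdeles_eq_one_of_pos L _ fun w hw => ?_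
  rw [val_globalToInfiniteUnits]
  exact hpos w hw

/-! ### §4. Archimedean Artin symbols are `2`-torsion -/

/-- **The Artin symbol of an archimedean idèle is `2`-torsion** (any finite abelian `L/K`): `u²` is a
square, hence lies in the identity component of `K_∞ˣ`, which `ψ_{L|K}` kills.  (The archimedean
decomposition groups have order `≤ 2`.) [cite: NeukirchANT1999, Ch. VI §5 Prop. (5.6)] -/
theorem artinIdeleMap_infiniteIdeles_sq_eq_one (u : (InfiniteAdeleRing K)ˣ) :
    artinIdeleMap L artinReciprocity_character_holds (infiniteIdeles K u) ^ 2 = 1 := by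
  rw [← map_pow, ← map_pow]
  have hconn : (QuotientGroup.mk (infiniteIdeles K (u ^ 2)) : ideleGroup K ⧸ principalIdeles K) ∈
      connectedComponent (1 : ideleGroup K ⧸ principalIdeles K) := by
    have hc : Continuous fun y : (InfiniteAdeleRing K)ˣ =>
        (QuotientGroup.mk (infiniteIdeles K y) : ideleGroup K ⧸ principalIdeles K) :=
      QuotientGroup.continuous_mk.comp (Automorphic.continuous_infiniteIdeles K)
    have h := hc.image_connectedComponent_subset (1 : (InfiniteAdeleRing K)ˣ)
    rw [map_one, QuotientGroup.mk_one] at h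
    exact h ⟨u ^ 2, sq_mem_connectedComponent_one_units_infiniteAdeleRing u, rfl⟩
  have hmem := connectedComponent_one_subset_normClassGroup L hconn
  rw [← ker_artinClassMap_eq L, SetLike.mem_coe, MonoidHom.mem_ker, artinClassMap_mk] at hmem
  exact hmem

/-- Hence `ψ(γ)` is `2`-torsion for any `γ ∈ Γ_K` lifting the archimedean Artin symbol of `b`: with
`sum_localInvariantMap_localization_cupProduct_δ₀_eq_neg_apply`, the finite invariant sum of a cyclic
class is killed by `2`. [cite: NeukirchANT1999, Ch. VI §5 Prop. (5.6)] -/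
theorem two_nsmul_apply_eq_zero_of_absRestrictNormalHom_eq {n : ℕ}
    (ψ : CyclicCharacter (absoluteGaloisGroup K) n) (hker : ψ.ker = galFixing K L)
    (u : (InfiniteAdeleRing K)ˣ) (γ : absoluteGaloisGroup K)
    (hγ : absRestrictNormalHom L γ = artinIdeleMap L artinReciprocity_character_holds (infiniteIdeles K u)) :
    2 • ψ γ = 0 := by
  have h2 : absRestrictNormalHom L (γ ^ 2) = 1 := by
    rw [map_pow, hγ, artinIdeleMap_infiniteIdeles_sq_eq_one]
  rw [absRestrictNormalHom_eq_one_iff] at h2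
  have hmem : γ ^ 2 ∈ ψ.ker := by rw [hker]; exact h2
  rw [CyclicCharacter.mem_ker, ψ.map_pow] at hmem
  exact hmem

end Literature.NumberTheory.GaloisCohomology

end
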